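import Summits.RiemannHypothesis.RiemannHypothesis.Theorems.SoloInformedPoleFree
import Summits.RiemannHypothesis.RiemannHypothesis.Theorems.SoloInformedWeilSurface
import Literature.NumberTheory.ConnesConsani2019.RiemannRochStrategy

/-!
# Motivic door (cell `pub-rhdoor`, seat cc-3): Connes–Consani 2019 eq. (15) holds

HONEST FRAMING (cell charter): lottery ticket at the motivic door; RH probability negligible;
consolation prizes are real.  This file is a consolation prize of the bookkeeping kind: it DISCHARGES
the named fact `Literature.NumberTheory.ConnesConsani2019.eq15` —

  `RiemannHypothesis ↔ (∀ f real test on ℝ₊^*, ∫ f d^*u = ∫ f du = 0 → 𝔰(f,f) ≤ 0)`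

(A. Connes, C. Consani, *The Riemann–Roch strategy*, arXiv:1805.10501, §3.1 eq. (15): "It is
known ([B3]) that RH is equivalent to the inequality …") — from theorems already in the tree, with
no new hypothesis and no named fact:

* `riemannHypothesis_iff_poleFree` (`SoloInformedPoleFree.lean`): `RH ⟺ Re Q(g) ≥ 0` for every
  complex test `g` with `ĝ(0) = ĝ(1) = 0`;
* the reduction to real tests (`SoloInformedWeilSurface.lean`: `re_weilQuadratic_eq_re_add_im`,
  `isWeilTest_ofReal_re/_im`), plus the splitting `ĝ(s) = (Re g)^(s) + i (Im g)^(s)` proved here;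
* the PROVED normalisation dictionary of `Literature/NumberTheory/ConnesConsani2019/RiemannRochStrategy.lean`:
  `2 𝔰(f,f) = weilPoleForm g − Re Q(g)` for `f = toMul u`, `g = u` real (`two_mul_ccPairing_toMul_eq`),
  `ĝ(0) = ∫ f d^*u`, `ĝ(1) = ∫ f du`.

So `criterion_iff_real_poleFree : Criterion ↔ (pole-free positivity over real tests)` and
`eq15_holds : eq15`.  Nothing here is progress on RH: (15) is Bombieri's form of Weil's criterion;
what the file certifies is that the cell's reading of CC's `𝔰`, `N`, masses and test class is the one
under which (15) is a theorem (the factor `½` and the constant `c = ½(log π + γ)` included).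

References: Connes–Consani 2019 §3.1 [ConnesConsani2019RiemannRochStrategy]; E. Bombieri, *Remarks on
Weil's quadratic functional I*, Rend. Mat. Acc. Lincei 11 (2000), Thm. 2 [Bombieri2000Weil].
-/

-- lint debt (one line): the D-0017 layout forces the doubled path component `RiemannHypothesis.RiemannHypothesis`.
set_option linter.dupNamespace false

namespace Summit.RiemannHypothesis.RiemannHypothesis.Theorems.MotivicDoor.ConnesConsani

open Complex Set MeasureTheory
open Literature.NumberTheory.LFunctions Literature.NumberTheory.ConnesConsani2019

/-- The Connes–Consani criterion (15), transported to the additive line, is exactly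
pole-free Weil positivity over REAL test functions. -/
theorem criterion_iff_real_poleFree :
    Criterion ↔ ∀ u : ℝ → ℝ, IsWeilTest (fun t ↦ (u t : ℂ)) →
      weilMellin (fun t ↦ (u t : ℂ)) 0 = 0 → weilMellin (fun t ↦ (u t : ℂ)) 1 = 0 →
        0 ≤ (weilQuadratic fun t ↦ (u t : ℂ)).re := by
  unfold Criterion
  refine forall₂_congr fun u hu ↦ ?_
  rw [weilMellin_zero_eq_massDstar, weilMellin_one_eq_massDu, Complex.ofReal_eq_zero,
    Complex.ofReal_eq_zero]
  refine imp_congr_right fun h0 ↦ imp_congr_right fun _ ↦ ?_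
  have h2 := two_mul_ccPairing_toMul_eq hu
  have hP : weilPoleForm (fun t ↦ (u t : ℂ)) = 0 :=
    weilPoleForm_eq_zero_of_poleFree hu (by rw [weilMellin_zero_eq_massDstar, h0]; simp)
  rw [hP] at h2
  constructor <;> intro h <;> linarith

/-- Splitting `ĝ(s)` into the transforms of the real and imaginary parts of `g`. -/
theorem weilMellin_eq_re_add_I_mul_im {g : ℝ → ℂ} (hg : IsWeilTest g) (s : ℂ) :
    weilMellin g s = weilMellin (fun t ↦ (((g t).re : ℝ) : ℂ)) s +
      I * weilMellin (fun t ↦ (((g t).im : ℝ) : ℂ)) s := by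
  have hgr := isWeilTest_ofReal_re hg
  have hgi := (isWeilTest_ofReal_im hg).const_mul I
  have hsplit : g = (fun t ↦ (((g t).re : ℝ) : ℂ)) + fun t ↦ I * (((g t).im : ℝ) : ℂ) := by
    funext t; simp only [Pi.add_apply]; rw [mul_comm]; exact (Complex.re_add_im (g t)).symm
  conv_lhs => rw [hsplit]
  rw [weilMellin_add hgr.1.continuous hgr.2 hgi.1.continuous hgi.2 s, weilMellin_const_mul]

/-- For `g` a test function with `ĝ(n) = 0` (`n = 0` or `1` encoded through the two real
transport lemmas): the real and imaginary parts have vanishing transform there too. -/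
theorem weilMellin_re_im_eq_zero {g : ℝ → ℂ} (hg : IsWeilTest g) {s : ℂ} {a b : ℝ}
    (ha : weilMellin (fun t ↦ (((g t).re : ℝ) : ℂ)) s = (a : ℂ))
    (hb : weilMellin (fun t ↦ (((g t).im : ℝ) : ℂ)) s = (b : ℂ)) (h : weilMellin g s = 0) :
    weilMellin (fun t ↦ (((g t).re : ℝ) : ℂ)) s = 0 ∧
      weilMellin (fun t ↦ (((g t).im : ℝ) : ℂ)) s = 0 := by
  rw [weilMellin_eq_re_add_I_mul_im hg s, ha, hb] at h
  have hre := congrArg Complex.re h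
  have him := congrArg Complex.im h
  simp at hre him
  rw [ha, hb, hre, him]
  simp

/-- **CC2019 eq. (15) holds**: RH ⟺ `𝔰(f,f) ≤ 0` for all real test `f` with both masses
zero — from the in-tree `riemannHypothesis_iff_poleFree` and the reduction to real tests. -/
theorem eq15_holds : eq15 := by
  rw [eq15, ← Summit.RiemannHypothesis_iff, riemannHypothesis_iff_poleFree,
    criterion_iff_real_poleFree]
  constructor
  · exact fun H u hu h0 h1 ↦ H _ hu h0 h1
  · intro H g hg h0 h1
    have hgr := isWeilTest_ofReal_re hg
    have hgi := isWeilTest_ofReal_im hg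
    obtain ⟨hr0, hi0⟩ := weilMellin_re_im_eq_zero hg
      (weilMellin_zero_eq_massDstar fun t ↦ (g t).re) (weilMellin_zero_eq_massDstar fun t ↦ (g t).im) h0
    obtain ⟨hr1, hi1⟩ := weilMellin_re_im_eq_zero hg
      (weilMellin_one_eq_massDu fun t ↦ (g t).re) (weilMellin_one_eq_massDu fun t ↦ (g t).im) h1
    rw [re_weilQuadratic_eq_re_add_im hg]
    exact add_nonneg (H _ hgr hr0 hr1) (H _ hgi hi0 hi1)

end Summit.RiemannHypothesis.RiemannHypothesis.Theorems.MotivicDoor.ConnesConsani
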